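import Summits.KontsevichZagierPeriods.Zeta5Search.Barrier.ConeGammaCuspSymmetricSpread

/-!
# ζ(5) search — BARRIER: the spread bound over one period — `|σ(δ) + σ(−δ) − E(δ)| ≤ Σ_b spread_b(δ)`; a cusp top must pay the lattice point with spread

HONEST FRAMING (cell `pub-zeta5`): systematic search; no irrationality claim unless kernel-certified. MODEL objects
under Brown–Zudilin's (28)+(30) accounting ([BZ22] = arXiv:2210.03391; (28) observed, not proved); nothing here is a
statement about `ζ(5)`, any `γ` of record, the sign or size of anything at a named direction (DATA), the cone's
supremum (C2 OPEN) or S-E (CONJECTURED); records in print UNMOVED. Prover P2 g26, assembly of the sequel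
`ConeGammaCuspSymmetricSpread` over one period with P2 g25's `ConeGammaCuspSymmetricSlope`.

With `σ = cuspSlope a T`, the END GERMS `E(δ) = germR(δ)(0) + germL(δ)(T) + germR(−δ)(0) + germL(−δ)(T) ≥ 0`
(`endGerms_nonneg`) and the decomposition `σ(δ) + σ(−δ) = E(δ) + Σ_{interior b} R_b(δ)`
(`cuspSlope_add_cuspSlope_neg_eq`), the junction-wise spread bound `abs_germ_symm_le_spread` gives:
* **`abs_cuspSlope_symm_sub_endGerms_le_spread`** — for every displacement `δ`, every admissible scale, and EVERY
  choice of pivots `c_m` and finsets `M_m ⊇` the members at the interior breakpoints `b_{m+1}`: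
  `|σ(δ) + σ(−δ) − E(δ)| ≤ Σ_m Σ_{k∈M_m} |φ_k(δ)/h_k(a) − c_m|`;
* **`endGerms_le_spread_of_isLocalMax`** — at a Regular OPEN-box direction with `Q > 0` that is a local maximiser of
  `γ`: `E(δ) ≤ Σ_m Σ_{k∈M_m} |φ_k(δ)/h_k(a) − c_m|` for every `δ` (with `interior_symm_le_neg_endGerms_of_isLocalMax`):
  a cusp top of the MODEL `γ` must, in EVERY displacement direction, absorb the lattice point's non-negative push by
  the spread of its interior junctions — directions that move the member walls of each junction together (small
  spread) are the ones a maximiser has to survive; `cuspSlope_symm_le_endGerms_add_spread` is the upper half alone.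
NOT here (honest): any evaluation of `E(δ)` or of a spread at a named direction, anything about `γ` of record, C2,
S-E, `ζ(5)`.
-/

noncomputable section

open Set MeasureTheory
open scoped Topology

namespace Summit.KontsevichZagierPeriods.Zeta5Search.Barrier.ConeGamma

/-- **THE SPREAD BOUND OVER ONE PERIOD.** All 28 forms positive, `T > 0` a period of the forms, `δ` a displacement,
`0 < ρ` an admissible scale (`ρK < 1`, `ρK < wallDist`, `2ρW ≤` every breakpoint gap), and for each interior breakpoint
`b_{m+1}` a finset `M m ⊇ {k : b_{m+1}·h_k(a) ∈ ℤ}` and a pivot `c m`. Then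
`|σ(δ) + σ(−δ) − E(δ)| ≤ Σ_{m < #bkpts − 2} Σ_{k ∈ M m} |φ_k(δ)/h_k(a) − c m|`. -/
theorem abs_cuspSlope_symm_sub_endGerms_le_spread {a : Dir} (hpos : ∀ k, 0 < h28 a k) {T : ℝ} (hT : 0 < T)
    (hper : ∀ k : Fin 28, ∃ z : ℤ, T * h28 a k = z) (δ : Fin 8 → ℝ) {ρ : ℝ} (hρ : 0 < ρ)
    (h1 : ρ * clusterBound a δ < 1) (h2 : ρ * clusterBound a δ < wallDist a T)
    (hgap : ∀ m, m + 1 < (bkpts a T).card → 2 * ρ * clusterWidth a δ ≤ bkpt a T (m + 1) - bkpt a T m)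
    (M : ℕ → Finset (Fin 28)) (hM : ∀ m, m + 2 < (bkpts a T).card →
      ∀ k, (∃ z : ℤ, bkpt a T (m + 1) * h28 a k = z) → k ∈ M m) (c : ℕ → ℝ) :
    |cuspSlope a T δ + cuspSlope a T (-δ) -
        (germR a δ ρ 0 + germL a δ ρ T + (germR a (-δ) ρ 0 + germL a (-δ) ρ T))| ≤
      ∑ m ∈ Finset.range ((bkpts a T).card - 2), ∑ k ∈ M m, |phiForm δ k / h28 a k - c m| := by
  rw [cuspSlope_add_cuspSlope_neg_eq hpos hT hper δ hρ h1 h2 hgap, add_sub_cancel_left]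
  refine (Finset.abs_sum_le_sum_abs _ _).trans (Finset.sum_le_sum fun m hm => ?_)
  have hm' : m + 2 < (bkpts a T).card := by have := Finset.mem_range.mp hm; omega
  exact abs_germ_symm_le_spread hpos (bkpt_mem (by omega)) (hM m hm') δ hρ h1 h2 (c m)

/-- **Upper half**: `σ(δ) + σ(−δ) ≤ E(δ) + Σ_m Σ_{k∈M m} |φ_k(δ)/h_k(a) − c m|`. -/
theorem cuspSlope_symm_le_endGerms_add_spread {a : Dir} (hpos : ∀ k, 0 < h28 a k) {T : ℝ} (hT : 0 < T)
    (hper : ∀ k : Fin 28, ∃ z : ℤ, T * h28 a k = z) (δ : Fin 8 → ℝ) {ρ : ℝ} (hρ : 0 < ρ)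
    (h1 : ρ * clusterBound a δ < 1) (h2 : ρ * clusterBound a δ < wallDist a T)
    (hgap : ∀ m, m + 1 < (bkpts a T).card → 2 * ρ * clusterWidth a δ ≤ bkpt a T (m + 1) - bkpt a T m)
    (M : ℕ → Finset (Fin 28)) (hM : ∀ m, m + 2 < (bkpts a T).card →
      ∀ k, (∃ z : ℤ, bkpt a T (m + 1) * h28 a k = z) → k ∈ M m) (c : ℕ → ℝ) :
    cuspSlope a T δ + cuspSlope a T (-δ) ≤
      (germR a δ ρ 0 + germL a δ ρ T + (germR a (-δ) ρ 0 + germL a (-δ) ρ T)) +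
        ∑ m ∈ Finset.range ((bkpts a T).card - 2), ∑ k ∈ M m, |phiForm δ k / h28 a k - c m| := by
  have h := abs_cuspSlope_symm_sub_endGerms_le_spread hpos hT hper δ hρ h1 h2 hgap M hM c
  rw [abs_le] at h
  linarith [h.2]

/-- **A CUSP TOP MUST PAY THE LATTICE POINT WITH SPREAD.** At a Regular OPEN-box direction with `Q = C₁ + δ₂₈ − Φ > 0`
that is a local maximiser of `γ` on `Dir`, for every period `T`, every displacement `δ`, every admissible scale and
EVERY choice of member finsets `M m` and pivots `c m` at the interior breakpoints:
`0 ≤ E(δ) ≤ Σ_m Σ_{k∈M m} |φ_k(δ)/h_k(a) − c m|` — the non-negative push of the lattice point (`endGerms_nonneg`) is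
absorbed by the L¹-spreads of the interior junctions (`interior_symm_le_neg_endGerms_of_isLocalMax` and the spread
bound). In a direction that moves the member walls of every junction together the right side vanishes, so such a
direction forces `E(δ) = 0`. -/
theorem endGerms_le_spread_of_isLocalMax {a : Dir}
    (hopen : ∀ j : Fin 7, 0 < sParam a j.succ ∧ sParam a j.succ < sParam a 0)
    {T : ℝ} (hT : 0 < T) (hper : ∀ k : Fin 28, ∃ z : ℤ, T * h28 a k = z) (δ : Fin 8 → ℝ)
    (hQ : 0 < C1 a + delta28 a - phi30 a) (hreg : Regular a) (hmax : IsLocalMax gamma a) {ρ : ℝ} (hρ : 0 < ρ)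
    (h1 : ρ * clusterBound a δ < 1) (h2 : ρ * clusterBound a δ < wallDist a T)
    (hgap : ∀ m, m + 1 < (bkpts a T).card → 2 * ρ * clusterWidth a δ ≤ bkpt a T (m + 1) - bkpt a T m)
    (M : ℕ → Finset (Fin 28)) (hM : ∀ m, m + 2 < (bkpts a T).card →
      ∀ k, (∃ z : ℤ, bkpt a T (m + 1) * h28 a k = z) → k ∈ M m) (c : ℕ → ℝ) :
    0 ≤ germR a δ ρ 0 + germL a δ ρ T + (germR a (-δ) ρ 0 + germL a (-δ) ρ T) ∧
    germR a δ ρ 0 + germL a δ ρ T + (germR a (-δ) ρ 0 + germL a (-δ) ρ T) ≤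
      ∑ m ∈ Finset.range ((bkpts a T).card - 2), ∑ k ∈ M m, |phiForm δ k / h28 a k - c m| := by
  have hpos : ∀ k, 0 < h28 a k := by
    intro k
    obtain ⟨h0a, -⟩ := hopen 0
    have hb : ∀ j : Fin 7, 0 < sParam a j.succ ∧ sParam a j.succ < sParam a 0 := hopen
    rw [← aOfS_sParam a, h28_aOfS]
    have e1 := hb 0; have e2 := hb 1; have e3 := hb 2; have e4 := hb 3; have e5 := hb 4; have e6 := hb 5
    have e7 := hb 6
    simp only [Fin.succ_zero_eq_one] at e1
    change 0 < sParam a 2 ∧ sParam a 2 < sParam a 0 at e2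
    change 0 < sParam a 3 ∧ sParam a 3 < sParam a 0 at e3
    change 0 < sParam a 4 ∧ sParam a 4 < sParam a 0 at e4
    change 0 < sParam a 5 ∧ sParam a 5 < sParam a 0 at e5
    change 0 < sParam a 6 ∧ sParam a 6 < sParam a 0 at e6
    change 0 < sParam a 7 ∧ sParam a 7 < sParam a 0 at e7
    fin_cases k <;> simp <;> linarith
  have hint := interior_symm_le_neg_endGerms_of_isLocalMax hopen hT hper δ hQ hreg hmax hρ h1 h2 hgap
  have hE := endGerms_nonneg hpos hper δ hρ.le h1
  have hlow : -(∑ m ∈ Finset.range ((bkpts a T).card - 2), ∑ k ∈ M m, |phiForm δ k / h28 a k - c m|) ≤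
      ∑ m ∈ Finset.range ((bkpts a T).card - 2),
        (germR a δ ρ (bkpt a T (m + 1)) + germL a δ ρ (bkpt a T (m + 1)) +
          germR a (-δ) ρ (bkpt a T (m + 1)) + germL a (-δ) ρ (bkpt a T (m + 1))) := by
    rw [← Finset.sum_neg_distrib]
    refine Finset.sum_le_sum fun m hm => ?_
    have hm' : m + 2 < (bkpts a T).card := by have := Finset.mem_range.mp hm; omega
    have h := abs_germ_symm_le_spread hpos (bkpt_mem (by omega)) (hM m hm') δ hρ h1 h2 (c m)
    rw [abs_le] at h
    exact h.1
  exact ⟨hE, by linarith⟩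

end Summit.KontsevichZagierPeriods.Zeta5Search.Barrier.ConeGamma

end
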